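import Literature.IUT.LogVolume.LogRadiusClosedForm
import HarnessLib

/-!
# [IUTchIV] Prop. 1.2 constants at a TAMELY ramified place of ANY ramification index: the budget
# `d + a + b < 1 + 1/(p−2) + k` once `p·e < p^{k+1}·(p−1)` — and `d + a + b < 41/5` at `p = 7`, `e < 6·7⁷`

Proof-only companion (classical local number theory; nothing disputed) of `RamificationInvariants.lean`
(`logRadiusA p e = a := ⌈e/(p−2)⌉/e`, `logRadiusB p e = b := ⌊log(p·e/(p−1))/log p⌋ − 1/e`, [IUTchIV] Prop. 1.2
p. 10), `DifferentEstimatesCorollaries.lean` (`differentOrd_eq_of_not_dvd`: `p ∤ e_K ⇒ d = (e_K−1)/e_K`, Serre,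
*Corps locaux* III §6 Prop. 13) and `LogRadiusClosedForm.lean` (the exact windows). The tree bounds `d + a + b`
either in the TAME RANGE `e ≤ p − 2` (`= 1`, `depthConstants_eq_one`-type closers) or by the DEGREE
(`depthConstants_lt : d + a + b < 4 + 2·log_p [K : ℚ_p]`). The abc-iut cell's window task «HEX-SHARP»
(HOME/plan/W/WINDOW-SPEC.md §6 (1)–(2)) needs the intermediate regime: the place is tamely ramified (`p ∤ e_K`) but
`e_K` is LARGE (`e_K ≫ p`), and the budget must come out as an ABSOLUTE constant once `e_K` is bounded (`b` is a
floor of a logarithm, so one power-of-`p` window for `e_K` pins it). Written by seat abc-iut-S-d1 (gen 8).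

* §1 `logRadiusA_le_of_two_lt` — `a ≤ 1/(p−2) + (p−3)/((p−2)·e)` (`⌈e/(p−2)⌉ ≤ (e + p − 3)/(p−2)`);
  `logRadiusB_le_of_lt_window` — `p·e < p^{k+1}·(p−1) ⇒ b ≤ k − 1/e` (upper window only).
* §2 `depthConstants_le_of_not_dvd` — `p > 2`, `p ∤ e_K`, `p·e_K < p^{k+1}(p−1)`:
  `d + a + b ≤ 1 + 1/(p−2) + k − (p−1)/((p−2)·e_K)`, hence `depthConstants_lt_of_not_dvd`: `< 1 + 1/(p−2) + k`;
  monotone packaging `depthConstants_lt_of_not_dvd_of_le` (`e_K ≤ E`, `p·E < p^{k+1}(p−1)`).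
* §3 `p = 7`: `depthConstants_seven_lt_of_not_dvd` (`7 ∤ e_K`, `7·e_K < 6·7^{k+1}` ⇒ `d + a + b < 6/5 + k`) and
  `depthConstants_seven_lt_41_5` (`7 ∤ e_K`, `e_K < 6·7⁷ = 4 941 258` ⇒ `d + a + b < 41/5`) — the constant `8.2 < 8.3`
  of WINDOW-SPEC §6 (3), valid for every `e_K ≤ 276480·l` with `l ≤ 17`.

What is NOT here: anything wild (`p ∣ e_K`; see `one_le_differentOrd_of_dvd`, `differentOrd_lt`), any log-shell or
log-volume statement, any elliptic curve. [cite: Mochizuki2012, IUTchIV Prop. 1.2 p. 10]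
[cite: SerreLocalFields1979, Ch. III §6 Prop. 13]
-/

noncomputable section

namespace Literature.IUT.LogVolume

/-! ## §1. One-sided bounds for `a` and `b` by integer windows -/

/-- **`a ≤ 1/(p−2) + (p−3)/((p−2)·e)`** for `p > 2`, `e ≥ 1`: `⌈e/(p−2)⌉ = (e + p − 3)/(p − 2)` in `ℕ`
(`logRadiusA_eq_ceilDiv`) and natural-number division rounds down. [cite: Mochizuki2012, IUTchIV Prop. 1.2 p. 10] -/
theorem logRadiusA_le_of_two_lt {p e : ℕ} (hp : 2 < p) (he : 1 ≤ e) :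
    logRadiusA p e ≤ 1 / ((p : ℝ) - 2) + ((p : ℝ) - 3) / (((p : ℝ) - 2) * e) := by
  rw [logRadiusA_eq_ceilDiv hp he]
  have he0 : (0 : ℝ) < e := by exact_mod_cast he
  have hp2 : (0 : ℝ) < (p : ℝ) - 2 := by
    have : (2 : ℝ) < p := by exact_mod_cast hp
    linarith
  have hdiv : (((e + (p - 3)) / (p - 2) : ℕ) : ℝ) ≤ ((e : ℝ) + ((p : ℝ) - 3)) / ((p : ℝ) - 2) := by
    have h := Nat.cast_div_le (m := e + (p - 3)) (n := p - 2) (α := ℝ)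
    have hc : (((p - 2 : ℕ) : ℝ)) = (p : ℝ) - 2 := by rw [Nat.cast_sub hp.le, Nat.cast_two]
    have hc' : (((e + (p - 3) : ℕ)) : ℝ) = (e : ℝ) + ((p : ℝ) - 3) := by
      rw [Nat.cast_add, Nat.cast_sub (by omega : 3 ≤ p)]; push_cast; ring
    rw [hc, hc'] at h
    exact h
  calc (((e + (p - 3)) / (p - 2) : ℕ) : ℝ) / e ≤ (((e : ℝ) + ((p : ℝ) - 3)) / ((p : ℝ) - 2)) / e :=
        div_le_div_of_nonneg_right hdiv he0.le
    _ = 1 / ((p : ℝ) - 2) + ((p : ℝ) - 3) / (((p : ℝ) - 2) * e) := by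
        field_simp

/-- **`p·e < p^{k+1}·(p−1) ⇒ b ≤ k − 1/e`** for `p > 1`, `e ≥ 1` (only the UPPER end of the window of
`logRadiusB_eq_of_window` is needed for the upper bound). [cite: Mochizuki2012, IUTchIV Prop. 1.2 p. 10] -/
theorem logRadiusB_le_of_lt_window {p e k : ℕ} (hp : 1 < p) (he : 1 ≤ e)
    (hhi : p * e < p ^ (k + 1) * (p - 1)) : logRadiusB p e ≤ (k : ℝ) - 1 / e := by
  have hp1 : (1 : ℝ) < p := by exact_mod_cast hp
  have hp0 : (0 : ℝ) < p := by linarith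
  have hp1' : (0 : ℝ) < (p : ℝ) - 1 := by linarith
  have he' : (0 : ℝ) < e := by exact_mod_cast he
  set x : ℝ := (p : ℝ) * e / ((p : ℝ) - 1) with hx
  have hx0 : 0 < x := div_pos (mul_pos hp0 he') hp1'
  have hhi' : x < (p : ℝ) ^ (k + 1) := by
    rw [hx, div_lt_iff₀ hp1']
    have h : ((p * e : ℕ) : ℝ) < ((p ^ (k + 1) * (p - 1) : ℕ) : ℝ) := by exact_mod_cast hhi
    rw [Nat.cast_mul, Nat.cast_mul, Nat.cast_pow, Nat.cast_sub hp.le, Nat.cast_one] at h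
    exact h
  have hfloor : (⌊Real.log x / Real.log p⌋ : ℝ) ≤ k := by
    have hlt : Real.log x / Real.log p < (k : ℝ) + 1 := by
      rw [Real.log_div_log, show (k : ℝ) + 1 = ((k + 1 : ℕ) : ℝ) by push_cast; ring,
        Real.logb_lt_iff_lt_rpow hp1 hx0, Real.rpow_natCast]
      exact hhi'
    have h1 : ⌊Real.log x / Real.log p⌋ < (k : ℤ) + 1 := by
      rw [Int.floor_lt]; push_cast; exact hlt
    have h2 : ⌊Real.log x / Real.log p⌋ ≤ (k : ℤ) := by omega
    exact_mod_cast h2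
  rw [logRadiusB, ← hx]
  linarith

/-! ## §2. The tame budget -/

section PadicField

variable (p : ℕ) [Fact p.Prime]
variable (K : Type*) [NontriviallyNormedField K] [NormedAlgebra ℚ_[p] K] [IsUltrametricDist K] [ProperSpace K]

/-- **`d + a + b ≤ 1 + 1/(p−2) + k − (p−1)/((p−2)·e_K)` at a tamely ramified place** (`p > 2`, `p ∤ e_K`) whose
ramification index satisfies `p·e_K < p^{k+1}·(p−1)`: `d = (e_K−1)/e_K`, `a ≤ 1/(p−2) + (p−3)/((p−2)e_K)`,
`b ≤ k − 1/e_K`. [cite: Mochizuki2012, IUTchIV Prop. 1.2 p. 10] [cite: SerreLocalFields1979, Ch. III §6 Prop. 13] -/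
theorem depthConstants_le_of_not_dvd {k : ℕ} (hp : 2 < p) (h : ¬ p ∣ absRamificationIdx p K)
    (hhi : p * absRamificationIdx p K < p ^ (k + 1) * (p - 1)) :
    differentOrd p K + logRadiusA p (absRamificationIdx p K) + logRadiusB p (absRamificationIdx p K) ≤
      1 + 1 / ((p : ℝ) - 2) + k - ((p : ℝ) - 1) / (((p : ℝ) - 2) * absRamificationIdx p K) := by
  have he := absRamificationIdx_pos p K
  have he' : (0 : ℝ) < absRamificationIdx p K := by exact_mod_cast he
  have hp2 : (0 : ℝ) < (p : ℝ) - 2 := by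
    have : (2 : ℝ) < p := by exact_mod_cast hp
    linarith
  have hd := differentOrd_eq_of_not_dvd p K h
  have ha := logRadiusA_le_of_two_lt (p := p) (e := absRamificationIdx p K) hp he
  have hb := logRadiusB_le_of_lt_window (p := p) (e := absRamificationIdx p K) (k := k) (by omega) he hhi
  have hident : ((absRamificationIdx p K : ℝ) - 1) / absRamificationIdx p K
      + (1 / ((p : ℝ) - 2) + ((p : ℝ) - 3) / (((p : ℝ) - 2) * absRamificationIdx p K))
      + ((k : ℝ) - 1 / absRamificationIdx p K)
      = 1 + 1 / ((p : ℝ) - 2) + k - ((p : ℝ) - 1) / (((p : ℝ) - 2) * absRamificationIdx p K) := by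
    field_simp
    ring
  rw [hd]
  linarith

/-- **`d + a + b < 1 + 1/(p−2) + k` at a tamely ramified place** (`p > 2`, `p ∤ e_K`, `p·e_K < p^{k+1}·(p−1)`).
[cite: Mochizuki2012, IUTchIV Prop. 1.2 p. 10] [cite: SerreLocalFields1979, Ch. III §6 Prop. 13] -/
theorem depthConstants_lt_of_not_dvd {k : ℕ} (hp : 2 < p) (h : ¬ p ∣ absRamificationIdx p K)
    (hhi : p * absRamificationIdx p K < p ^ (k + 1) * (p - 1)) :
    differentOrd p K + logRadiusA p (absRamificationIdx p K) + logRadiusB p (absRamificationIdx p K) <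
      1 + 1 / ((p : ℝ) - 2) + k := by
  have h1 := depthConstants_le_of_not_dvd p K hp h hhi
  have he' : (0 : ℝ) < absRamificationIdx p K := by exact_mod_cast absRamificationIdx_pos p K
  have hp2 : (0 : ℝ) < (p : ℝ) - 2 := by
    have : (2 : ℝ) < p := by exact_mod_cast hp
    linarith
  have hpos : 0 < ((p : ℝ) - 1) / (((p : ℝ) - 2) * absRamificationIdx p K) := by
    apply div_pos (by linarith) (mul_pos hp2 he')
  linarith

/-- Monotone packaging: the same with the window imposed on an UPPER BOUND `E` of `e_K` (`e_K ≤ E`,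
`p·E < p^{k+1}·(p−1)`). [cite: Mochizuki2012, IUTchIV Prop. 1.2 p. 10] -/
theorem depthConstants_lt_of_not_dvd_of_le {k E : ℕ} (hp : 2 < p) (h : ¬ p ∣ absRamificationIdx p K)
    (hE : absRamificationIdx p K ≤ E) (hhi : p * E < p ^ (k + 1) * (p - 1)) :
    differentOrd p K + logRadiusA p (absRamificationIdx p K) + logRadiusB p (absRamificationIdx p K) <
      1 + 1 / ((p : ℝ) - 2) + k :=
  depthConstants_lt_of_not_dvd p K hp h (lt_of_le_of_lt (Nat.mul_le_mul_left p hE) hhi)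

end PadicField

/-! ## §3. `p = 7` (the HEX family of the abc-iut window: bad prime `7` of `λ_k = 1/2 + 2/7^k`) -/

section Seven

variable (p : ℕ) [Fact p.Prime]
variable (K : Type*) [NontriviallyNormedField K] [NormedAlgebra ℚ_[p] K] [IsUltrametricDist K] [ProperSpace K]

/-- **`p = 7`, tamely ramified, `7·e_K < 6·7^{k+1}`: `d + a + b < 6/5 + k`** (stated for a prime `p` with
`p = 7`, so that it applies verbatim under the consumer's `Fact (Nat.Prime p)` instance).
[cite: Mochizuki2012, IUTchIV Prop. 1.2 p. 10] [cite: SerreLocalFields1979, Ch. III §6 Prop. 13] -/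
theorem depthConstants_seven_lt_of_not_dvd (hp7 : p = 7) {k : ℕ} (h : ¬ p ∣ absRamificationIdx p K)
    (hhi : 7 * absRamificationIdx p K < 7 ^ (k + 1) * 6) :
    differentOrd p K + logRadiusA p (absRamificationIdx p K) + logRadiusB p (absRamificationIdx p K) <
      6 / 5 + k := by
  subst hp7
  have h1 := depthConstants_lt_of_not_dvd 7 K (k := k) (by norm_num) h (by simpa using hhi)
  norm_num at h1
  linarith

/-- **`p = 7`, tamely ramified, `e_K < 6·7⁷ = 4 941 258`: `d + a + b < 41/5`** (`= 8.2`; the HEX-SHARP budget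
`C ≤ 83/10` of HOME/plan/W/WINDOW-SPEC.md §6 (3), valid e.g. for every `e_K ≤ 276480·l` with `l ≤ 17`).
[cite: Mochizuki2012, IUTchIV Prop. 1.2 p. 10] [cite: SerreLocalFields1979, Ch. III §6 Prop. 13] -/
theorem depthConstants_seven_lt_41_5 (hp7 : p = 7) (h : ¬ p ∣ absRamificationIdx p K)
    (hE : absRamificationIdx p K < 6 * 7 ^ 7) :
    differentOrd p K + logRadiusA p (absRamificationIdx p K) + logRadiusB p (absRamificationIdx p K) <
      41 / 5 := by
  have h1 := depthConstants_seven_lt_of_not_dvd p K hp7 (k := 7) h (by omega)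
  norm_num at h1 ⊢
  linarith

/-- **`p = 7`, tamely ramified, `e_K < 6·7⁸ = 34 588 806`: `d + a + b < 46/5`** (`= 9.2 < 93/10`; covers
`e_K ≤ 276480·l` for every `l ≤ 125`). [cite: Mochizuki2012, IUTchIV Prop. 1.2 p. 10]
[cite: SerreLocalFields1979, Ch. III §6 Prop. 13] -/
theorem depthConstants_seven_lt_46_5 (hp7 : p = 7) (h : ¬ p ∣ absRamificationIdx p K)
    (hE : absRamificationIdx p K < 6 * 7 ^ 8) :
    differentOrd p K + logRadiusA p (absRamificationIdx p K) + logRadiusB p (absRamificationIdx p K) <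
      46 / 5 := by
  have h1 := depthConstants_seven_lt_of_not_dvd p K hp7 (k := 8) h (by omega)
  norm_num at h1 ⊢
  linarith

end Seven

end Literature.IUT.LogVolume

end
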